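import Summits.BirchSwinnertonDyer.BirchSwinnertonDyer.Theorems.GenusKolyvaginAtTwoMinimalTwinBSDTwoOddManinPinning
import Literature.NumberTheory.EllipticCurves.ManinConstantConductorLt500000
import Summits.BirchSwinnertonDyer.BirchSwinnertonDyer.Theses.ManinLocalTwoThree
import HarnessLib

/-!
# Route `GenusKolyvaginAtTwo`, crux U₂ `MinimalTwinBSDTwo` (stmt-BirchSwinnertonDyer-22985), LINE 23 «twin_swap» — MANIN|₄ ON CREMONA'S RANGE:
# every `E[2]`-irreducible globally minimal `W/ℚ` whose class has an optimal Manin constant `±1` — in particular every `W` of conductor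
# `N_W ≤ 500000` (Cremona's verification, as cited by Česnavičius–Neururer–Saha) — carries a datum with ODD Manin constant, at ANY `v₂(N)`; and the
# stub MANIN|₄ itself is route item 22967 `ManinLocalTwoThree.ManinOddAtFour` BY NAME

Seat `bsd-line-gk2-p2` g37 (PROVER seat 2/3, cell `bsd-f1-sign2`, LINE 23 holder), `--supports stmt-BirchSwinnertonDyer-22985 --as helper`.
THEOREMS ONLY (no definition, no named fact, no `sorry`).  BSD is NOT proved by any of this; U₂ is NOT proved; MANIN|₄ is NOT proved; nothing is closed.

WHAT.  The g37 transport `OddManin.exists_datum_odd_c_of_isIsogenous_odd_c` (p828855: an odd Manin constant anywhere in an `E[2]`-irreducible class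
moves to `W` along an odd isogeny) composed with the tree's class predicate `ClassAbsManinConstantEqOne W` («every globally minimal lattice-optimal datum of
`W`'s class has `|c| = 1`», `ManinConstantClassCertificate.lean`) and the optimal datum of Edixhoven's Prop. 2
(`ModularParametrizationData.exists_optimalDatum_of_edixhoven`, tree theorem):
* §1 `exists_datum_odd_c_of_classAbsManinConstantEqOne` — `ClassAbsManinConstantEqOne W` ⟹ a datum of `W` (same newform / period pair / uniformisation as
  any given one) with odd `c`.  UNCONDITIONAL (the class predicate is the displayed hypothesis: one Cremona table row / one ARS full-space certificate).
* §2 `exists_datum_odd_c_of_cremona_le_500000` — the same for every datum level `N ≤ 500000`, modulo the named DATUM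
  `cremona_abs_maninConstant_eq_one_of_level_le_500000` (Cremona's `ecdata/manin.txt` computation as cited in the refereed text Česnavičius–Neururer–Saha,
  JEMS 26 (2024) §1: «Cremona … prove[d] in [Cre22] that the Manin conjecture holds whenever `N ≤ 500000`»; `ManinConstantConductorLe300000.lean`).
* §3 in LINE 23's currency: `exists_datum_odd_c_conductor_of_conductorNorm_le_500000` (+ modularity `nonempty_modularParametrizationData` for a datum of
  `W` to transport) and ★ `oddCutManinResidue_of_conductorNorm_le_500000` = the registered stub MANIN|₄ `TwinSwapV213.OddCutManinResidueAtTwo` with the ONE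
  extra binder `N_W ≤ 500000`, i.e. **MANIN|₄ restricted to Cremona's range is DISCHARGED** (modulo Cremona's datum + modularity); only the cut's image
  hypothesis is used (`ρ̄_{W,2}` onto ⟹ `E[2]` irreducible), the other binders are idle.  So the research content of MANIN|₄ lives entirely at
  `v₂(N_W) ≥ 2 ∧ N_W > 500000`: §4 `forall_oddManinDatum_onCut_iff_forall_of_conductorNorm_gt_500000` = the stub text ⟺ the stub text with the extra
  binder `500000 < N_W` (a kernel-certified split for the pen).
* §5 `exists_datum_odd_c_iff_of_isIsogenous` — the MANIN|₄ instance «∃ odd-c datum» is invariant along `ℚ`-isogenies of `E[2]`-irreducible curves.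
* §6 ★★ `oddCutManinResidue_of_maninOddAtFour` — **the stub MANIN|₄ is route item stmt-BirchSwinnertonDyer-22967 `ManinLocalTwoThree.ManinOddAtFour` BY NAME**
  (plus its displayed facts Mazur / Abbes–Ullmo / Česnavičius / modularity and `nonempty_modularParametrizationData`): the stub text VERBATIM follows; and
  `not_two_dvd_maninConstant_optimal_of_exists_odd` = the partial converse in 22967's currency.  So LINE 23 can write MANIN|₄ as «22967 BY NAME».

HONEST FRAMING.  Datum grade: §2–§3 rest on a completed computation (Cremona) asserted in a refereed secondary text, typed in the tree as a named fact;
nothing here is a theorem about Manin's conjecture.  BSD is NOT proved.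

References: [Cremona2022ManinConstants] `ecdata/manin.txt` ¶1, ¶ «Concerning the Manin constant»; [CesnaviciusNeururerSaha2023] §1 p. 574 and ref. [Cre22];
[AgasheRibetStein2006] Thm. 2.6, appendix §5; [EdixhovenManin1991] Prop. 2; [GreenbergVatsal2000] §3 Rem. 3.4.
-/

set_option autoImplicit false
set_option linter.dupNamespace false -- `Summit.<P>.<Sub>` repeats `BirchSwinnertonDyer` (D-0017)

noncomputable section

open scoped Classical MatrixGroups ModularForm NumberField

namespace Summit.BirchSwinnertonDyer.BirchSwinnertonDyer.Theorems.GenusExact.TwinSwap.OddManin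

open Literature.NumberTheory.EllipticCurves WeierstrassCurve CongruenceSubgroup
  Literature.NumberTheory.EllipticCurves.ModularForms

/-! ## §1 From the class predicate `ClassAbsManinConstantEqOne` -/

/-- **A class whose optimal Manin constant is `±1` has an odd-`c` datum on every `E[2]`-irreducible member.**  `W/ℚ` globally minimal elliptic with `E[2]`
irreducible and a datum `Dt` at level `N`; if every globally minimal lattice-optimal datum of `W`'s isogeny class has `|c| = 1`
(`ClassAbsManinConstantEqOne W`), then `W` carries a datum at level `N` with the same newform, period pair and uniformisation as `Dt` and ODD Manin
constant.  Unconditional (the class predicate is displayed). [cite: EdixhovenManin1991, Prop. 2] [cite: GreenbergVatsal2000, §3, Remark 3.4]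
[cite: AgasheRibetStein2006, appendix §5 (the certificate the predicate records)] -/
theorem exists_datum_odd_c_of_classAbsManinConstantEqOne
    (W : WeierstrassCurve ℚ) [W.IsElliptic] [W.IsGloballyMinimal] (hirr : W.HasIrreducibleModPGaloisRep 2)
    {N : ℕ} [NeZero N] (Dt : ModularParametrizationData W N) (hcl : ClassAbsManinConstantEqOne W) :
    ∃ Dk : ModularParametrizationData W N, Dk.f = Dt.f ∧ Dk.L = Dt.L ∧ Dk.uniformize = Dt.uniformize ∧ Odd Dk.c := by
  obtain ⟨W₀, hW₀, hW₀', D₀, -, hiso, hopt, -⟩ := Dt.exists_optimalDatum_of_edixhoven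
    (fun hf' hL' q hq hq' ↦ edixhoven_int_of_neronLattice_eq_smul_periodLattice_holds hf' hL' q hq hq')
  have h1 : |D₀.maninConstant| = 1 := hcl W₀ D₀ hiso hopt
  have hodd : Odd D₀.c := by
    have h1' : |D₀.c| = 1 := h1
    rcases (abs_eq (zero_le_one : (0 : ℤ) ≤ 1)).mp h1' with h | h <;> rw [h] <;> decide
  exact exists_datum_odd_c_of_isIsogenous_odd_c W hirr Dt W₀ D₀ hiso hodd

/-! ## §2 On Cremona's range `N ≤ 500000` -/

/-- **Odd Manin datum at every level `N ≤ 500000`** for a globally minimal `E[2]`-irreducible `W/ℚ` carrying a datum `Dt` at level `N`, modulo the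
named datum `cremona_abs_maninConstant_eq_one_of_level_le_500000` (Cremona's verification `c = ±1` for optimal curves of conductor `≤ 500000`, as
cited by Česnavičius–Neururer–Saha 2024 §1): the optimal datum of the class (Edixhoven) is at level `N`, has `|c₀| = 1`, and the transport gives an
odd-`c` datum of `W`.  CONDITIONAL on the displayed datum. [cite: CesnaviciusNeururerSaha2023, §1 p. 574 and ref. [Cre22]]
[cite: Cremona2022ManinConstants, manin.txt ¶ "Concerning the Manin constant"] [cite: EdixhovenManin1991, Prop. 2] -/
theorem exists_datum_odd_c_of_cremona_le_500000 (h500 : cremona_abs_maninConstant_eq_one_of_level_le_500000)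
    (W : WeierstrassCurve ℚ) [W.IsElliptic] [W.IsGloballyMinimal] (hirr : W.HasIrreducibleModPGaloisRep 2)
    {N : ℕ} [NeZero N] (Dt : ModularParametrizationData W N) (hN : N ≤ 500000) :
    ∃ Dk : ModularParametrizationData W N, Dk.f = Dt.f ∧ Dk.L = Dt.L ∧ Dk.uniformize = Dt.uniformize ∧ Odd Dk.c := by
  obtain ⟨W₀, hW₀, hW₀', D₀, -, hiso, hopt, -⟩ := Dt.exists_optimalDatum_of_edixhoven
    (fun hf' hL' q hq hq' ↦ edixhoven_int_of_neronLattice_eq_smul_periodLattice_holds hf' hL' q hq hq')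
  have h1 : |D₀.maninConstant| = 1 := h500 W₀ D₀ hopt hN
  have hodd : Odd D₀.c := by
    have h1' : |D₀.c| = 1 := h1
    rcases (abs_eq (zero_le_one : (0 : ℤ) ≤ 1)).mp h1' with h | h <;> rw [h] <;> decide
  exact exists_datum_odd_c_of_isIsogenous_odd_c W hirr Dt W₀ D₀ hiso hodd

/-! ## §3 In LINE 23's currency -/

/-- **Odd Manin datum at level `N_W ≤ 500000`** for a globally minimal `E[2]`-irreducible `W/ℚ`, modulo Cremona's datum and the modularity fact
`nonempty_modularParametrizationData` (which supplies a datum of `W` at level `N_W` to transport).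
[cite: CesnaviciusNeururerSaha2023, §1 p. 574 and ref. [Cre22]] [cite: BCDTJAMS2001, Thm. A] -/
theorem exists_datum_odd_c_conductor_of_conductorNorm_le_500000 (h500 : cremona_abs_maninConstant_eq_one_of_level_le_500000)
    (hmodD : nonempty_modularParametrizationData)
    (W : WeierstrassCurve ℚ) [W.IsElliptic] [W.IsGloballyMinimal] [NeZero (W.conductorNorm ℤ)] (hirr : W.HasIrreducibleModPGaloisRep 2)
    (hN : W.conductorNorm ℤ ≤ 500000) :
    ∃ Dt : ModularParametrizationData W (W.conductorNorm ℤ), Odd Dt.c := by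
  obtain ⟨D⟩ := hmodD W
  obtain ⟨Dk, -, -, -, hk⟩ := exists_datum_odd_c_of_cremona_le_500000 h500 W hirr D hN
  exact ⟨Dk, hk⟩

/-- **★ MANIN|₄ RESTRICTED TO CREMONA'S RANGE IS DISCHARGED.**  The registered stub `TwinSwapV213.stub_oddCutManinResidue : OddCutManinResidueAtTwo` of
LINE 23 v2.13.1 reads «for every `W` on the odd habitat cut with `¬CM`, `r_an = 1`, `#Sel₂ = 2` and `4 ∣ N_W`, `∃ Dt : ModularParametrizationData W N_W`
with `Odd Dt.c`»; here the SAME text with the one extra binder `N_W ≤ 500000` is proved, modulo Cremona's datum (`c = ±1` for optimal curves of conductor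
`≤ 500000`, cited by Česnavičius–Neururer–Saha 2024 §1) and modularity.  Only the image hypothesis (`ρ_{W,2^n}` onto, at `n = 1`) is used; the other
binders are idle.  The research content of MANIN|₄ is therefore confined to `v₂(N_W) ≥ 2 ∧ N_W > 500000`.  BSD is NOT proved; MANIN|₄ is NOT proved.
[cite: CesnaviciusNeururerSaha2023, §1 p. 574 and ref. [Cre22]] [cite: Cremona2022ManinConstants, manin.txt ¶ "Concerning the Manin constant"]
[cite: EdixhovenManin1991, Prop. 2] [cite: GreenbergVatsal2000, §3, Remark 3.4] -/
theorem oddCutManinResidue_of_conductorNorm_le_500000 (h500 : cremona_abs_maninConstant_eq_one_of_level_le_500000)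
    (hmodD : nonempty_modularParametrizationData) :
    ∀ (W : WeierstrassCurve ℚ) [W.IsElliptic] [W.IsGloballyMinimal] [NeZero (W.conductorNorm ℤ)],
      ¬ W.HasCM → W.analyticRank = 1 → Nat.card (W.selmerGroup 2) = 2 → Odd W.tamagawaProduct →
      (∀ n : ℕ, 0 < n → W.HasSurjectiveModNGaloisRep ((2 : ℤ) ^ n)) →
      (∃ v : IsDedekindDomain.HeightOneSpectrum (𝓞 ℚ), ((2 : ℕ) : 𝓞 ℚ) ∉ v.asIdeal ∧ ((W.conductorNorm ℤ : ℕ) : 𝓞 ℚ) ∈ v.asIdeal ∧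
        W.HasMultiplicativeReductionAt v) →
      4 ∣ W.conductorNorm ℤ → W.conductorNorm ℤ ≤ 500000 → ∃ Dt : ModularParametrizationData W (W.conductorNorm ℤ), Odd Dt.c :=
  fun W _ _ _ _ _ _ _ hρ _ _ hN ↦ exists_datum_odd_c_conductor_of_conductorNorm_le_500000 h500 hmodD W
    (hasIrreducibleModPGaloisRep_two_of_forall_hasSurjectiveModNGaloisRep W hρ) hN

/-- **The same in U₂'s own hypotheses** (analytic rank `1` and `#Sel₂(W) = 2` give `E[2]` irreducible via GZK for the rank): a globally minimal `W` of
analytic rank `1` with `#Sel₂(W) = 2` and `N_W ≤ 500000` has a datum at level `N_W` with odd Manin constant, modulo Cremona's datum + modularity + GZK.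
BSD is NOT proved. [cite: CesnaviciusNeururerSaha2023, §1 p. 574 and ref. [Cre22]] [cite: EdixhovenManin1991, Prop. 2] -/
theorem exists_datum_odd_c_conductor_of_analyticRank_one_of_conductorNorm_le_500000
    (h500 : cremona_abs_maninConstant_eq_one_of_level_le_500000) (hmodD : nonempty_modularParametrizationData)
    (hGZK : rank_eq_analyticRank_of_analyticRank_le_one)
    (W : WeierstrassCurve ℚ) [W.IsElliptic] [W.IsGloballyMinimal] [NeZero (W.conductorNorm ℤ)] (hr : W.analyticRank = 1)
    (hSel : Nat.card (W.selmerGroup 2) = 2) (hN : W.conductorNorm ℤ ≤ 500000) :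
    ∃ Dt : ModularParametrizationData W (W.conductorNorm ℤ), Odd Dt.c :=
  exists_datum_odd_c_conductor_of_conductorNorm_le_500000 h500 hmodD W
    (hasIrreducibleModPGaloisRep_two_of_analyticRank_one_of_natCard_selmerGroup_two hGZK W hr hSel) hN


/-! ## §4 The stub splits by conductor: MANIN|₄ ⟺ MANIN|₄ on `N_W > 500000` -/

/-- **MANIN|₄ is equivalent to its restriction to conductor `> 500000`** (modulo Cremona's datum + modularity): the left side is the text of the
registered stub `TwinSwapV213.OddCutManinResidueAtTwo` verbatim (LINE 23 v2.13.1), the right side the same text with the one extra binder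
`500000 < N_W`.  For the pen: the research content of MANIN|₄ is «Manin's conjecture mod `2` for the strong Weil curves of conductor `> 500000` with
`v₂(N) ≥ 2` in an `E[2]`-surjective class» (by `exists_datum_odd_c_conductor_iff_forall_optimal_odd`, p828855, it is exactly that).  BSD is NOT proved;
MANIN|₄ is NOT proved. [cite: CesnaviciusNeururerSaha2023, §1 p. 574 and ref. [Cre22]] [cite: EdixhovenManin1991, Prop. 2] -/
theorem forall_oddManinDatum_onCut_iff_forall_of_conductorNorm_gt_500000 (h500 : cremona_abs_maninConstant_eq_one_of_level_le_500000)
    (hmodD : nonempty_modularParametrizationData) :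
    (∀ (W : WeierstrassCurve ℚ) [W.IsElliptic] [W.IsGloballyMinimal] [NeZero (W.conductorNorm ℤ)],
      ¬ W.HasCM → W.analyticRank = 1 → Nat.card (W.selmerGroup 2) = 2 → Odd W.tamagawaProduct →
      (∀ n : ℕ, 0 < n → W.HasSurjectiveModNGaloisRep ((2 : ℤ) ^ n)) →
      (∃ v : IsDedekindDomain.HeightOneSpectrum (𝓞 ℚ), ((2 : ℕ) : 𝓞 ℚ) ∉ v.asIdeal ∧ ((W.conductorNorm ℤ : ℕ) : 𝓞 ℚ) ∈ v.asIdeal ∧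
        W.HasMultiplicativeReductionAt v) →
      4 ∣ W.conductorNorm ℤ → ∃ Dt : ModularParametrizationData W (W.conductorNorm ℤ), Odd Dt.c) ↔
    (∀ (W : WeierstrassCurve ℚ) [W.IsElliptic] [W.IsGloballyMinimal] [NeZero (W.conductorNorm ℤ)],
      ¬ W.HasCM → W.analyticRank = 1 → Nat.card (W.selmerGroup 2) = 2 → Odd W.tamagawaProduct →
      (∀ n : ℕ, 0 < n → W.HasSurjectiveModNGaloisRep ((2 : ℤ) ^ n)) →
      (∃ v : IsDedekindDomain.HeightOneSpectrum (𝓞 ℚ), ((2 : ℕ) : 𝓞 ℚ) ∉ v.asIdeal ∧ ((W.conductorNorm ℤ : ℕ) : 𝓞 ℚ) ∈ v.asIdeal ∧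
        W.HasMultiplicativeReductionAt v) →
      4 ∣ W.conductorNorm ℤ → 500000 < W.conductorNorm ℤ → ∃ Dt : ModularParametrizationData W (W.conductorNorm ℤ), Odd Dt.c) := by
  refine ⟨fun h W _ _ _ hcm hr hSel hT hρ hv h4 _ ↦ h W hcm hr hSel hT hρ hv h4, fun h W _ _ _ hcm hr hSel hT hρ hv h4 ↦ ?_⟩
  by_cases hN : W.conductorNorm ℤ ≤ 500000
  · exact exists_datum_odd_c_conductor_of_conductorNorm_le_500000 h500 hmodD W
      (hasIrreducibleModPGaloisRep_two_of_forall_hasSurjectiveModNGaloisRep W hρ) hN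
  · exact h W hcm hr hSel hT hρ hv h4 (not_le.mp hN)


/-! ## §5 The MANIN|₄ instance is an invariant of the odd-isogeny class -/

/-- **«Some datum has odd Manin constant» is invariant along `ℚ`-isogenies of `E[2]`-irreducible curves.**  For globally minimal `W, W'` over `ℚ`, both
with `E[2]` irreducible, `ℚ`-isogenous, carrying data `Dt`, `Dt'` at level `N`: `(∃ Dk on W, Odd Dk.c) ↔ (∃ Dk' on W', Odd Dk'.c)` — the transport
`exists_datum_odd_c_of_isIsogenous_odd_c` (p828855) in both directions (isogeny symmetry: Silverman AEC III.6.1).  Unconditional.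
[cite: SilvermanAEC2009, Thm. VI.4.1 (b), Thm. III.6.1 (a)] [cite: EdixhovenManin1991, Prop. 2] -/
theorem exists_datum_odd_c_iff_of_isIsogenous
    (W W' : WeierstrassCurve ℚ) [W.IsElliptic] [W.IsGloballyMinimal] [W'.IsElliptic] [W'.IsGloballyMinimal]
    (hirr : W.HasIrreducibleModPGaloisRep 2) (hirr' : W'.HasIrreducibleModPGaloisRep 2)
    {N : ℕ} [NeZero N] (Dt : ModularParametrizationData W N) (Dt' : ModularParametrizationData W' N) (hiso : W.IsIsogenous W') :
    (∃ Dk : ModularParametrizationData W N, Odd Dk.c) ↔ ∃ Dk' : ModularParametrizationData W' N, Odd Dk'.c := by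
  refine ⟨fun ⟨Dk, hk⟩ ↦ ?_, fun ⟨Dk', hk'⟩ ↦ ?_⟩
  · obtain ⟨D, -, -, -, hD⟩ := exists_datum_odd_c_of_isIsogenous_odd_c W' hirr' Dt' W Dk hiso.symm_of_charZero hk
    exact ⟨D, hD⟩
  · obtain ⟨D, -, -, -, hD⟩ := exists_datum_odd_c_of_isIsogenous_odd_c W hirr Dt W' Dk' hiso hk'
    exact ⟨D, hD⟩


/-! ## §6 MANIN|₄ BY NAME on route ManinLocalTwoThree: item 22967 `ManinOddAtFour` pays the stub -/

/-- **MANIN|₄ ⟸ `ManinLocalTwoThree.ManinOddAtFour` (stmt-BirchSwinnertonDyer-22967) BY NAME**, per curve: for `W/ℚ` globally minimal with `E[2]` irreducible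
and `4 ∣ N_W`, granted the crux `ManinOddAtFour` of route ManinLocalTwoThree («Mazur → Abbes–Ullmo → Česnavičius → modularity → every lattice-optimal
datum at a level `N` with `4 ∣ N` has odd Manin constant») together with its four displayed named facts and the modularity fact
`nonempty_modularParametrizationData` (a datum of `W` to transport): `W` has a datum at level `N_W` with ODD Manin constant.  Mechanism: Edixhoven's optimal
datum `(W₀, D₀)` at level `N_W` (tree theorem) is odd by 22967, and the odd-isogeny transport (p828855) moves it to `W`.  CONDITIONAL on the displayed
route item + facts; BSD is NOT proved; 22967 is NOT proved here. [cite: EdixhovenManin1991, Prop. 2] [cite: GreenbergVatsal2000, §3, Remark 3.4]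
[cite: AgasheRibetStein2006, Thm. 2.2] -/
theorem exists_datum_odd_c_conductor_of_maninOddAtFour
    (hM : Summit.BirchSwinnertonDyer.BirchSwinnertonDyer.Theses.ManinLocalTwoThree.ManinOddAtFour)
    (hMaz : mazur_not_dvd_maninConstant_of_odd) (hAU : abbesUllmo_not_dvd_maninConstant_of_not_dvd_level)
    (hCes : cesnavicius_not_two_dvd_maninConstant_of_two_dvd_level) (hnf : exists_isNewformOf) (hmodD : nonempty_modularParametrizationData)
    (W : WeierstrassCurve ℚ) [W.IsElliptic] [W.IsGloballyMinimal] [NeZero (W.conductorNorm ℤ)] (hirr : W.HasIrreducibleModPGaloisRep 2)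
    (h4 : 4 ∣ W.conductorNorm ℤ) :
    ∃ Dt : ModularParametrizationData W (W.conductorNorm ℤ), Odd Dt.c := by
  obtain ⟨D⟩ := hmodD W
  obtain ⟨W₀, hW₀, hW₀', D₀, -, hiso, hopt, -⟩ := D.exists_optimalDatum_of_edixhoven
    (fun hf' hL' q hq hq' ↦ edixhoven_int_of_neronLattice_eq_smul_periodLattice_holds hf' hL' q hq hq')
  have h2 : ¬ (2 : ℤ) ∣ D₀.maninConstant := hM hMaz hAU hCes hnf W₀ D₀ hopt (by norm_num; exact h4)
  have hodd : Odd D₀.c := by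
    rcases Int.even_or_odd D₀.c with h | h
    · exact absurd (even_iff_two_dvd.mp h) h2
    · exact h
  obtain ⟨Dk, -, -, -, hk⟩ := exists_datum_odd_c_of_isIsogenous_odd_c W hirr D W₀ D₀ hiso hodd
  exact ⟨Dk, hk⟩

/-- **★★ THE STUB MANIN|₄ OF LINE 23 IS ITEM 22967 BY NAME.**  Granted the crux `ManinLocalTwoThree.ManinOddAtFour` (stmt-BirchSwinnertonDyer-22967) of route
ManinLocalTwoThree, its four displayed named facts (Mazur 1978 Cor. 4.1, Abbes–Ullmo 1996 Thm. A, Česnavičius 2018 Thm. 1.2, modularity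
`exists_isNewformOf`) and `nonempty_modularParametrizationData`, the text of the registered stub `TwinSwapV213.stub_oddCutManinResidue :
OddCutManinResidueAtTwo` holds VERBATIM (all binders of the stub; only `ρ_{W,2^n}` onto and `4 ∣ N_W` are used).  For the pen: MANIN|₄ can be written
«22967 BY NAME» — then every stub of LINE 23 is a route item by name, a named fact, or one of the research leaves NVFROB / WITNESS_{dc,≥2} / KEX|off.
CONDITIONAL on 22967 (open: it is Manin's conjecture mod `2` at additive `2`); BSD is NOT proved; U₂ is NOT proved. [cite: EdixhovenManin1991, Prop. 2]
[cite: GreenbergVatsal2000, §3, Remark 3.4] [cite: CesnaviciusNeururerSaha2023, §1 (status of Manin's conjecture at additive primes)] -/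
theorem oddCutManinResidue_of_maninOddAtFour
    (hM : Summit.BirchSwinnertonDyer.BirchSwinnertonDyer.Theses.ManinLocalTwoThree.ManinOddAtFour)
    (hMaz : mazur_not_dvd_maninConstant_of_odd) (hAU : abbesUllmo_not_dvd_maninConstant_of_not_dvd_level)
    (hCes : cesnavicius_not_two_dvd_maninConstant_of_two_dvd_level) (hnf : exists_isNewformOf) (hmodD : nonempty_modularParametrizationData) :
    ∀ (W : WeierstrassCurve ℚ) [W.IsElliptic] [W.IsGloballyMinimal] [NeZero (W.conductorNorm ℤ)],
      ¬ W.HasCM → W.analyticRank = 1 → Nat.card (W.selmerGroup 2) = 2 → Odd W.tamagawaProduct →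
      (∀ n : ℕ, 0 < n → W.HasSurjectiveModNGaloisRep ((2 : ℤ) ^ n)) →
      (∃ v : IsDedekindDomain.HeightOneSpectrum (𝓞 ℚ), ((2 : ℕ) : 𝓞 ℚ) ∉ v.asIdeal ∧ ((W.conductorNorm ℤ : ℕ) : 𝓞 ℚ) ∈ v.asIdeal ∧
        W.HasMultiplicativeReductionAt v) →
      4 ∣ W.conductorNorm ℤ → ∃ Dt : ModularParametrizationData W (W.conductorNorm ℤ), Odd Dt.c :=
  fun W _ _ _ _ _ _ _ hρ _ h4 ↦ exists_datum_odd_c_conductor_of_maninOddAtFour hM hMaz hAU hCes hnf hmodD W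
    (hasIrreducibleModPGaloisRep_two_of_forall_hasSurjectiveModNGaloisRep W hρ) h4

/-- **Partial converse: on `E[2]`-surjective classes MANIN|₄'s instances decide 22967's instances.**  If `W` (globally minimal, `E[2]` irreducible) has a
datum with odd Manin constant at level `N`, then EVERY globally minimal lattice-optimal datum of `W`'s class at level `N` has odd Manin constant — the
`W`-class instance of `ManinOddAtFour`'s conclusion (p828855 `odd_optimal_c_of_odd_c`, restated in 22967's currency `¬ 2 ∣ D₀.maninConstant`).
Unconditional. [cite: EdixhovenManin1991, Prop. 2] [cite: GreenbergVatsal2000, §3, Remark 3.4] -/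
theorem not_two_dvd_maninConstant_optimal_of_exists_odd
    (W : WeierstrassCurve ℚ) [W.IsElliptic] [W.IsGloballyMinimal] (hirr : W.HasIrreducibleModPGaloisRep 2)
    {N : ℕ} [NeZero N] (h : ∃ Dt : ModularParametrizationData W N, Odd Dt.c)
    (W₀ : WeierstrassCurve ℚ) [W₀.IsElliptic] [W₀.IsGloballyMinimal] (D₀ : ModularParametrizationData W₀ N)
    (hiso : W.IsIsogenous W₀) (hopt : ∀ z ∈ D₀.L.lattice, ∃ w ∈ periodLattice D₀.f, z = (D₀.c : ℂ) * w) :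
    ¬ (2 : ℤ) ∣ D₀.maninConstant := by
  obtain ⟨Dt, hodd⟩ := h
  have hodd₀ : Odd D₀.c := odd_optimal_c_of_odd_c W hirr Dt hodd W₀ D₀ hiso hopt
  exact fun h2 ↦ (Int.not_even_iff_odd.mpr hodd₀) (even_iff_two_dvd.mpr h2)

end Summit.BirchSwinnertonDyer.BirchSwinnertonDyer.Theorems.GenusExact.TwinSwap.OddManin

end
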